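import Summits.Ventures.PercRepro.S2BasesTriangles

/-!
# PercRepro — S2: THREE TRIANGLES — THE ARITHMETIC OF THE HITTING LEVER (p7, gen 14; sub-claim S2; the cell `(14, 6)`)

Two small facts for the three-triangle bound on the top `5`-sets at corank `6` (S2FourteenSixSpread): the third of three distinct
triangles has a point outside the first two (pairwise they share `≤ 1` point), and the inclusion–exclusion count
`#top5 + C(a, 5) + C(b, 5) ≤ 15504 + C(c, 5)` with `14 ≤ a, b ≤ 15`, `11 ≤ c ≤ 14`, `c + 1 ≤ a, b` gives `#top5 ≤ 12787`
(the worst case `a = b = 14`, `c = 13`). Axioms: standard.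
-/

open scoped Matroid

namespace PercRepro

namespace ThmN

open Set

variable {α : Type}

/-- The arithmetic of the three-triangle bound: `#top5 + C(a, 5) + C(b, 5) ≤ 15504 + C(c, 5)` with `14 ≤ a, b ≤ 15`,
`11 ≤ c ≤ 14`, `c + 1 ≤ a`, `c + 1 ≤ b` gives `#top5 ≤ 12787`. -/
theorem top_five_le_of_three_bound (x a b c : ℕ) (ha1 : 14 ≤ a) (ha2 : a ≤ 15) (hb1 : 14 ≤ b) (hb2 : b ≤ 15)
    (hc1 : 11 ≤ c) (hc2 : c ≤ 14) (hca : c + 1 ≤ a) (hcb : c + 1 ≤ b)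
    (h : x + a.choose 5 + b.choose 5 ≤ 15504 + c.choose 5) :
    x ≤ 12787 := by
  interval_cases a <;> interval_cases b <;> interval_cases c <;> norm_num [Nat.choose] at h <;> omega

/-- Three distinct triangles: the third has a point outside the first two (pairwise they share `≤ 1` point). -/
theorem exists_mem_triangle_notMem_union (M : Matroid α) [M.Finite]
    (hC1 : ∀ L ⊆ M.E, M.eRk L = 2 → L.ncard ≤ 3)
    {T₁ T₂ T₃ : Set α} (hT₁ : M.IsCircuit T₁) (hT₁3 : T₁.ncard = 3) (hT₂ : M.IsCircuit T₂) (hT₂3 : T₂.ncard = 3)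
    (hT₃ : M.IsCircuit T₃) (hT₃3 : T₃.ncard = 3) (h13 : T₁ ≠ T₃) (h23 : T₂ ≠ T₃) :
    ∃ x ∈ T₃, x ∉ T₁ ∪ T₂ := by
  have hfin : ∀ {T : Set α}, M.IsCircuit T → T.Finite := fun hT => M.ground_finite.subset hT.subset_ground
  have hi13 : (T₁ ∩ T₃).ncard ≤ 1 := by
    have hu := S2.five_le_ncard_union_of_triangles M hC1 hT₁ hT₁3 hT₃ hT₃3 h13
    have hs := Set.ncard_union_add_ncard_inter T₁ T₃ (hfin hT₁) (hfin hT₃)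
    omega
  have hi23 : (T₂ ∩ T₃).ncard ≤ 1 := by
    have hu := S2.five_le_ncard_union_of_triangles M hC1 hT₂ hT₂3 hT₃ hT₃3 h23
    have hs := Set.ncard_union_add_ncard_inter T₂ T₃ (hfin hT₂) (hfin hT₃)
    omega
  by_contra hcon
  push Not at hcon
  have hsub : T₃ ⊆ (T₁ ∩ T₃) ∪ (T₂ ∩ T₃) := fun x hx =>
    (hcon x hx).elim (fun h => Or.inl ⟨h, hx⟩) (fun h => Or.inr ⟨h, hx⟩)
  have h1 := Set.ncard_le_ncard hsub (((hfin hT₁).inter_of_left _).union ((hfin hT₂).inter_of_left _))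
  have h2 := Set.ncard_union_le (T₁ ∩ T₃) (T₂ ∩ T₃)
  omega

end ThmN

end PercRepro
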